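import Summits.CriticalPhenomena.PercolationContinuityZ3.Theorems.PercNearOneGluingAdditiveGluingConnEventEval

/-!
# `AdditiveGluing` (crux stmt-CriticalPhenomena-4576), the (K₀-set) line: the candidate intermediate (W_cS) is FALSE —
# an explicit six-vertex weighted path refutes it (exact rational evaluation, kernel-checked tables)

Support file (certificate seat `prim-cert-2`; `--supports stmt-CriticalPhenomena-4576`; COMPUTATIONAL: one `native_decide`
evaluation of `ConnEventEval.evalQs`).  In the notation of the set-gluing kernel (K₀-set) = `stub_k0set3_g2` (target `b`,
observer `o`, spectator `c`, relay set `S`, designated weakest relay `s₀ ∈ S`, `cf = {c ↮ S}`, `Γ_x = {x ↮ b, x ↔ S, b ↔ S}`,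
`Γ_{s₀} = {s₀ ↮ b, b ↔ S}`), the inequality

  (W_cS)  `μ(cf) · μ(Γ_o ∩ {c ↔ S}) ≤ μ(cf ∩ {o ↔ c}) · μ(Γ_c) + μ(cf ∩ {o ↮ c}) · μ(Γ_{s₀} ∩ {c ↔ S})`

was proposed as an intermediate step towards (K₀-set) and reported false by the ttrl `k0set` census (request png-k0set-large:
29 171 exact violations among the exhaustive `n = 7` instances, 134 in the large-`n` gadget wave; coordinator relay 2026-08-19:
"DROP W_cS EVERYWHERE").  `wcS_counterexample` records a minimal exact witness found by this seat: the weighted PATH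
`5 —(4/5)— 1 —(3/4)— 3 —(1/5)— 2 —(1/3)— 0 —(1/3)— 4` on `Fin 6` (all other pairs weight `0`; no pair glued), roles
`o = 1, b = 2, c = 0, S = {3,4,5}`, where `s₀ = 4` is the UNIQUE weakest relay (`μ(4↔2) = 1/9 < 3/25 = μ(5↔2) < 1/5 = μ(3↔2)`),
and `μ(cf) = 28/45, μ(Γ_o ∩ {c↔S}) = 8/75, μ(cf ∩ {o↔c}) = 0, μ(Γ_c) = 2/45, μ(cf ∩ {o↮c}) = 28/45, μ(Γ_{s₀} ∩ {c↔S}) = 4/45`, so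
`LHS = 224/3375 > 112/2025 = RHS` (margin `−112/10125`).  `not_WcS`: hence (W_cS) fails even under all the side conditions
(`|S| = 3`, all roles distinct and outside `S`, strict unique minimiser, no glued pair).  (K₀-set), X1 and Xb themselves hold at
this witness (census: 0 violations anywhere); only the intermediate is refuted.
-/

namespace Summit.CriticalPhenomena.PercolationContinuityZ3.Theorems.SetGlueWcS

open Finset MeasureTheory OneCutCert CovTransferCert ConnEventEval
open scoped BigOperators
open Literature.Probability.Percolation Literature.Probability.LatticeModels

/-! ## The witness -/

/-- The edge weights of the witness, indexed like `edgeE 6` (pairs `(0,1),(0,2),…,(4,5)`): the path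
`5 — 1 — 3 — 2 — 0 — 4` with weights `4/5, 3/4, 1/5, 1/3, 1/3`. [this work] -/
def xsW : List ℚ := [0, 1/3, 0, 1/3, 0, 0, 3/4, 0, 4/5, 1/5, 0, 0, 0, 0, 0]

/-- The weights lie in `[0,1]`. [this work] -/
theorem xsW_mem : ∀ x ∈ xsW, 0 ≤ x ∧ x ≤ 1 := by norm_num [xsW]

/-- The weights are `< 1` (no glued pair). [this work] -/
theorem xsW_lt_one : ∀ x ∈ xsW, x < 1 := by norm_num [xsW]

/-- The weight vector of the witness on `K₆`. [this work] -/
noncomputable def wW : Sym2 (Fin 6) → unitInterval := wtab 6 xsW xsW_mem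

/-- The connectivity predicates evaluated (in the order: `cf`, `Γ_o ∩ {c↔S}`, `cf ∩ {o↔c}`, `Γ_c`, `cf ∩ {o↮c}`,
`Γ_{s₀} ∩ {c↔S}`, `{s₀↔b}`, `{3↔b}`, `{5↔b}`), roles `o = 1, b = 2, c = 0, S = {3,4,5}, s₀ = 4`. [this work] -/
def predsW : List (CRel 6 → Bool) :=
  [ fun r => !(r 0 3 || r 0 4 || r 0 5),
    fun r => !(r 1 2) && (r 1 3 || r 1 4 || r 1 5) && (r 3 2 || r 4 2 || r 5 2) && (r 0 3 || r 0 4 || r 0 5),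
    fun r => !(r 0 3 || r 0 4 || r 0 5) && r 1 0,
    fun r => !(r 0 2) && (r 0 3 || r 0 4 || r 0 5) && (r 3 2 || r 4 2 || r 5 2),
    fun r => !(r 0 3 || r 0 4 || r 0 5) && !(r 1 0),
    fun r => !(r 4 2) && (r 3 2 || r 4 2 || r 5 2) && (r 0 3 || r 0 4 || r 0 5),
    fun r => r 4 2, fun r => r 3 2, fun r => r 5 2 ]

/-- **The exact evaluation** (kernel-checked tables, exact rational arithmetic; `native_decide`). [this work] -/
theorem evalQs_W : evalQs 6 xsW predsW = [28/45, 8/75, 0, 2/45, 28/45, 4/45, 1/9, 1/5, 3/25] := by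
  native_decide

/-- The probability of the `k`-th listed event. [this work] -/
theorem prW (k : ℕ) (hk : k < predsW.length) :
    (prodBernoulli wW).real (connEvent (predsW[k])) =
      ((([28/45, 8/75, 0, 2/45, 28/45, 4/45, 1/9, 1/5, 3/25] : List ℚ).getD k 0 : ℚ) : ℝ) :=
  real_connEvent_of_evalQs xsW_mem evalQs_W k hk

/-! ## The events of the statement are the listed connectivity events -/

/-- `S = {3,4,5}`. [this work] -/
private abbrev SW : Finset (Fin 6) := {3, 4, 5}

/-- `cf = {c ↮ S}` is the first listed event. [this work] -/
private theorem ev_cf :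
    ((⋃ s ∈ SW, (openConn (0 : Fin 6) s : Set (BondConfig (Fin 6))))ᶜ) = connEvent (predsW[0]) := by
  ext ω; simp [connEvent, predsW, and_assoc]

/-- `Γ_o ∩ {c ↔ S}` is the second listed event. [this work] -/
private theorem ev_Go :
    ((openConn (1 : Fin 6) 2)ᶜ ∩ (⋃ s ∈ SW, (openConn (1 : Fin 6) s : Set (BondConfig (Fin 6)))) ∩
        (⋃ s ∈ SW, (openConn s (2 : Fin 6) : Set (BondConfig (Fin 6)))) ∩
        (⋃ s ∈ SW, (openConn (0 : Fin 6) s : Set (BondConfig (Fin 6))))) = connEvent (predsW[1]) := by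
  ext ω; simp [connEvent, predsW, and_assoc, or_assoc]

/-- `cf ∩ {o ↔ c}` is the third listed event. [this work] -/
private theorem ev_cfoc :
    ((⋃ s ∈ SW, (openConn (0 : Fin 6) s : Set (BondConfig (Fin 6))))ᶜ ∩ openConn (1 : Fin 6) 0) =
      connEvent (predsW[2]) := by
  ext ω; simp [connEvent, predsW, and_assoc]

/-- `Γ_c` is the fourth listed event. [this work] -/
private theorem ev_Gc :
    ((openConn (0 : Fin 6) 2)ᶜ ∩ (⋃ s ∈ SW, (openConn (0 : Fin 6) s : Set (BondConfig (Fin 6)))) ∩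
        (⋃ s ∈ SW, (openConn s (2 : Fin 6) : Set (BondConfig (Fin 6))))) = connEvent (predsW[3]) := by
  ext ω; simp [connEvent, predsW, and_assoc, or_assoc]

/-- `cf ∩ {o ↮ c}` is the fifth listed event. [this work] -/
private theorem ev_cfnoc :
    ((⋃ s ∈ SW, (openConn (0 : Fin 6) s : Set (BondConfig (Fin 6))))ᶜ ∩ (openConn (1 : Fin 6) 0)ᶜ) =
      connEvent (predsW[4]) := by
  ext ω; simp [connEvent, predsW, and_assoc]

/-- `Γ_{s₀} ∩ {c ↔ S}` is the sixth listed event. [this work] -/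
private theorem ev_Gs0 :
    ((openConn (4 : Fin 6) 2)ᶜ ∩ (⋃ s ∈ SW, (openConn s (2 : Fin 6) : Set (BondConfig (Fin 6)))) ∩
        (⋃ s ∈ SW, (openConn (0 : Fin 6) s : Set (BondConfig (Fin 6))))) = connEvent (predsW[5]) := by
  ext ω; simp [connEvent, predsW, and_assoc, or_assoc]

/-- `{s ↔ b}` as a connectivity event. [this work] -/
private theorem ev_tau (s : Fin 6) : (openConn s (2 : Fin 6) : Set (BondConfig (Fin 6))) = connEvent (fun r => r s 2) := by
  ext ω; simp [connEvent]

/-! ## The refutation -/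

/-- **An exact counterexample to (W_cS)** with every side condition one might add: `|S| = 3`, the roles `o, b, c` pairwise
distinct and outside `S`, `s₀ ∈ S` the unique (strict) minimiser of `μ(s ↔ b)`, no glued pair (all weights `< 1`), and
nevertheless `RHS < LHS`. [this work] -/
theorem wcS_counterexample : ∃ (n : ℕ) (w : Sym2 (Fin n) → unitInterval) (S : Finset (Fin n)) (o b c s₀ : Fin n),
    S.card = 3 ∧ o ∉ S ∧ b ∉ S ∧ c ∉ S ∧ o ≠ b ∧ o ≠ c ∧ b ≠ c ∧ s₀ ∈ S ∧
    (∀ s ∈ S, s ≠ s₀ → (prodBernoulli w).real (openConn s₀ b) < (prodBernoulli w).real (openConn s b)) ∧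
    (∀ e, (w e : ℝ) < 1) ∧
    (prodBernoulli w).real ((⋃ s ∈ S, (openConn c s : Set (BondConfig (Fin n))))ᶜ ∩ openConn o c) *
          (prodBernoulli w).real ((openConn c b)ᶜ ∩ (⋃ s ∈ S, (openConn c s : Set (BondConfig (Fin n)))) ∩
            (⋃ s ∈ S, (openConn s b : Set (BondConfig (Fin n))))) +
        (prodBernoulli w).real ((⋃ s ∈ S, (openConn c s : Set (BondConfig (Fin n))))ᶜ ∩ (openConn o c)ᶜ) *
          (prodBernoulli w).real ((openConn s₀ b)ᶜ ∩ (⋃ s ∈ S, (openConn s b : Set (BondConfig (Fin n)))) ∩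
            (⋃ s ∈ S, (openConn c s : Set (BondConfig (Fin n))))) <
      (prodBernoulli w).real ((⋃ s ∈ S, (openConn c s : Set (BondConfig (Fin n))))ᶜ) *
        (prodBernoulli w).real ((openConn o b)ᶜ ∩ (⋃ s ∈ S, (openConn o s : Set (BondConfig (Fin n)))) ∩
          (⋃ s ∈ S, (openConn s b : Set (BondConfig (Fin n)))) ∩ (⋃ s ∈ S, (openConn c s : Set (BondConfig (Fin n))))) := by
  refine ⟨6, wW, SW, 1, 2, 0, 4, by decide, by decide, by decide, by decide, by decide, by decide, by decide, by decide,
    ?_, ?_, ?_⟩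
  · -- strict unique minimiser
    intro s hs hne
    have h4 : (prodBernoulli wW).real (openConn (4 : Fin 6) 2) = ((1/9 : ℚ) : ℝ) := by
      rw [ev_tau]; exact prW 6 (by decide)
    have h3 : (prodBernoulli wW).real (openConn (3 : Fin 6) 2) = ((1/5 : ℚ) : ℝ) := by
      rw [ev_tau]; exact prW 7 (by decide)
    have h5 : (prodBernoulli wW).real (openConn (5 : Fin 6) 2) = ((3/25 : ℚ) : ℝ) := by
      rw [ev_tau]; exact prW 8 (by decide)
    simp only [SW, Finset.mem_insert, Finset.mem_singleton] at hs
    rcases hs with rfl | rfl | rfl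
    · rw [h4, h3]; norm_num
    · exact absurd rfl hne
    · rw [h4, h5]; norm_num
  · -- no glued pair
    intro e
    unfold wW wtab
    split_ifs with h
    · show ((xsW.getD (Classical.choose h).val 0 : ℚ) : ℝ) < 1
      rcases getD_mem_or_zero xsW (Classical.choose h).val with hm | h0
      · exact_mod_cast xsW_lt_one _ hm
      · rw [h0]; norm_num
    · simp
  · -- the inequality fails
    rw [ev_Go, ev_cfoc, ev_Gc, ev_cfnoc, ev_Gs0, ev_cf, prW 0 (by decide), prW 1 (by decide), prW 2 (by decide), prW 3 (by decide),
      prW 4 (by decide), prW 5 (by decide)]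
    norm_num

/-- **(W_cS) is false**, even restricted to `|S| = 3`, pairwise distinct roles outside `S`, a strict unique minimiser and weights
`< 1`. [this work] -/
theorem not_WcS : ¬ ∀ (n : ℕ) (w : Sym2 (Fin n) → unitInterval) (S : Finset (Fin n)) (o b c s₀ : Fin n),
    S.card = 3 → o ∉ S → b ∉ S → c ∉ S → o ≠ b → o ≠ c → b ≠ c → s₀ ∈ S →
    (∀ s ∈ S, s ≠ s₀ → (prodBernoulli w).real (openConn s₀ b) < (prodBernoulli w).real (openConn s b)) →
    (∀ e, (w e : ℝ) < 1) →
    (prodBernoulli w).real ((⋃ s ∈ S, (openConn c s : Set (BondConfig (Fin n))))ᶜ) *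
        (prodBernoulli w).real ((openConn o b)ᶜ ∩ (⋃ s ∈ S, (openConn o s : Set (BondConfig (Fin n)))) ∩
          (⋃ s ∈ S, (openConn s b : Set (BondConfig (Fin n)))) ∩ (⋃ s ∈ S, (openConn c s : Set (BondConfig (Fin n))))) ≤
      (prodBernoulli w).real ((⋃ s ∈ S, (openConn c s : Set (BondConfig (Fin n))))ᶜ ∩ openConn o c) *
          (prodBernoulli w).real ((openConn c b)ᶜ ∩ (⋃ s ∈ S, (openConn c s : Set (BondConfig (Fin n)))) ∩
            (⋃ s ∈ S, (openConn s b : Set (BondConfig (Fin n))))) +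
        (prodBernoulli w).real ((⋃ s ∈ S, (openConn c s : Set (BondConfig (Fin n))))ᶜ ∩ (openConn o c)ᶜ) *
          (prodBernoulli w).real ((openConn s₀ b)ᶜ ∩ (⋃ s ∈ S, (openConn s b : Set (BondConfig (Fin n)))) ∩
            (⋃ s ∈ S, (openConn c s : Set (BondConfig (Fin n))))) := by
  intro h
  obtain ⟨n, w, S, o, b, c, s₀, hcard, ho, hb, hc, hob, hoc, hbc, hs₀, hmin, hlt, hfail⟩ := wcS_counterexample
  exact absurd (h n w S o b c s₀ hcard ho hb hc hob hoc hbc hs₀ hmin hlt) (not_le.2 hfail)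

end Summit.CriticalPhenomena.PercolationContinuityZ3.Theorems.SetGlueWcS
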